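import Summits.ValiantsHypothesis.ValiantsHypothesis.Cruxes.DualUnipotentThreeHalves.Lines.radical_split
import Summits.ValiantsHypothesis.ValiantsHypothesis.Theorems.GrenetZeonDualUnipotentThreeHalvesHeavyTopKrylovSeed
import Summits.ValiantsHypothesis.ValiantsHypothesis.Theorems.GrenetZeonDualUnipotentThreeHalvesHeavyTopWeightThinBlocks
import Summits.ValiantsHypothesis.ValiantsHypothesis.Theorems.GrenetZeonDualUnipotentThreeHalvesHeavyTopInvariantFlag
import Summits.ValiantsHypothesis.ValiantsHypothesis.Theorems.GrenetZeonDualUnipotentThreeHalvesHeavyTopFlagWeightThin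
import Summits.ValiantsHypothesis.ValiantsHypothesis.Theorems.GrenetZeonDualUnipotentThreeHalvesHeavyTopRegimeBudget
import Summits.ValiantsHypothesis.ValiantsHypothesis.Theorems.GrenetZeonDualUnipotentThreeHalvesHeavyTopCoarseFlag
import Summits.ValiantsHypothesis.ValiantsHypothesis.Theorems.GrenetZeonDualUnipotentThreeHalvesHeavyTopBlockMass

/-!
# LINE `krylov_seed` — crux `GrenetZeon.DualUnipotentThreeHalves` (stmt-ValiantsHypothesis-24318), residue R2 `HeavyTopLaw`
# (director-valiant g16 R280 (2) / R282 (3): first WAVE-2 line; card `Cruxes/DualUnipotentThreeHalves/Ideas/krylov-seed.md` rev 8,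
# val-idea-26 g0, critic val-idea-crit-7 g0 VERDICT #1 PASS; SEEDSPEC `Cruxes/DualUnipotentThreeHalves/SEEDSPEC-krylov-seed.md` v0.2)

SKELETON (crux-plan shape; drafted by the LEAD PROVER val-port-2 g2 because the line planner val-idea-26 g0 closed its session at
17:21Z before R282 (3) reached it — see val-width INBOX 18:00:47Z; texts and vocabulary are val-idea-26's, by name).

TRANSFERRED CRUX.  C⁺ := `KrylovSeed.UniformWeightLaw` (✓ p652777, def): in the regime `C₀ m² < n³`, every top-heavy affine nilpotent
`m × m` pencil over `ℂ^{n×n}` is `WeightThin n m N` — ONE constant weight flag (change of basis `P`, levels `lvl < p`, drop `r`, climb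
`c ≥ 1`) and ONE direction space `K` certify it.  PROVED joints (✓ p652963, val-idea-26 / val-port-3 g2): `flagCheap_of_weightThin`
(weight-thin ⇒ flag-cheap, = Theorem G″ ✓ p645496) and `heavyTopLaw_of_uniformWeightLaw : UniformWeightLaw → HeavyTopLaw`; so C⁺ ⇒ R2 ⇒
(with ✓ R1 `radicalCoarsening`, p623799, and the `radical_split` composition `dualUnipotentThreeHalves_of_law`) the crux BY NAME.

THE SPLIT (R280 (2) / crit-7 17:18:47Z: `UniformWeightLaw` is NOT registered in one piece).  Let `W = ℂ·N(0) + N_lin(ℂ^{n×n})` be the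
nilpotent linear space of the pencil.  A CHEAP BLOCK FLAG of the pencil (`HasCheapBlockFlag`) is a constant conjugation making the whole
pencil block-upper for a level function with `p` levels whose Theorem-G budget `p·n + Σ_t C(#block_t, 2) < n²` holds (the hypothesis
shape of ✓ p645496 `flagCheap_of_invariant_levels`, verbatim).
* S3 `stub_invariantFlagLocus` — **THE FLAG LOCUS IS WEIGHT-THIN** (`FlagWeightLaw`; provable NOW, M-sized: Theorem G's graded Gerstenhaber
  count in weight currency — ✓ p653819 `weightThin_of_block_levels` supplies the certificate once `K = {tops vanishing on the diagonal
  blocks}` is shown to have codimension `≤ Σ_t C(#block_t,2)`, which is ✓ port-4 g2's `finrank_blockSpan_le` / `flagCheap_of_block_dims`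
  machinery (p648849) + `finrank_le_choose_two`).  Probe vs R2: implies R2 on the flag locus (already TRUE there by G — consistent);
  vs the summit: nothing (restricted class).  Second hand: val-port-4 g2.
* S1 `stub_seedExists` — **THE RESIDUAL WEIGHT LAW** (`ResidualWeightLaw`; LAW tier, research — the line's content): in the regime,
  a top-heavy affine nilpotent pencil WITHOUT a cheap block flag is nevertheless weight-thin.  This locus CONTAINS R2's
  residual class of record (INSTANCES.md v2.4 §7: `W` has a FAT irreducible block; equality «no cheap block flag ⇒ a fat composition
  factor» is the lead's L4 STRUCTURE lemma, OPEN — crit-7 L-2 — a composition factor of size `> √(2n)` — cf. ✓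
  port-4 g2 `exists_block_conj`, p648257).  ROUTES (the card's mechanism, both typed in the tree): (K) KRYLOV SEEDS — S2 below: a seed `S`
  whose Krylov flag `F_{t+1} = S + F_t + W·F_t` reaches `⊤` in `p` steps with a lifting space `K` of dimension `> (⌊(p+n−2)/2⌋+1)·n` gives
  `WeightThin` with `r = c = 1` (✓ `weightThin_of_krylov`); (T) TORUS GRADINGS of `W` from its stabiliser (SEEDSPEC §3; every grading IS
  a weight flag, so (T) needs no lemma).  CALIBRATION (kernel / cell, by name): C⁺ fails together with R2's instance at (4,7) —
  ✓ `not_weightThin_NSeven` (p652963) over ✓ p648631 `not_heavyTopInst_four_seven` — and the cell (val-htc-lead 17:44:58Z) certified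
  `¬ WeightThin` for the band patterns P₁₀ at (5,10) and P₁₂ at (6,12): like R2, C⁺ needs `C₀ ≥ 2`; the residual class IS inhabited
  (val-idea-29's monoliths W₆@(4,6), W₇@(4,7), W₉@(5,9): irreducible, full index — val-idea-26 17:16:50Z) and every monolith tested so
  far IS weight-thin (W₆, W₉ with `(p,r,c) = (3,1,1)`, W₇ with `(3,1,2)` and `(5,1,3)`; htc-lead 17:49:57Z): no counter-candidate to C⁺
  inside the regime is known.  Probe vs R2: S1 ∧ S2 ⇒ C⁺ ⇒ R2 (kernel, below); S1 is STRONGER than R2 on its class (one flag for all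
  lines); vs the summit: via `radical_split` only (R2 is that line's last open stub).  WHY IT MIGHT FAIL: a «nilpotent quasi-expander»
  (card §Lever: every seed at every scale has fat glue and its Krylov tower keeps ≥ half of the n² tops non-lifting) — no example in
  print (MOR 1991 §5, MMS 2012) or in the dossier; cheapest falsifier = the cell's complete level-function DP (`lead/patdp.py`) on the
  first ι-engine outputs at (6,12..15)/(7,20) (SEEDSPEC §6).
* S2 `stub_seedToWeightThin` — **SEED ⇒ WEIGHT-THIN** (lemma B; CLOSED ON ARRIVAL by ✓ `KrylovSeed.weightThin_of_krylov`): the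
  registered joint through which any seed-existence result for the residual class discharges S1 on its sub-class.
L4 RESHAPE (cycle 1, crit-7 L-1): S1 is CUT into S1a `stub_coarseFlag` (COARSE FLAG LEMMA, M, provable: a small-block
structure at scale `s` coarsens into a cheap block flag when `(m/s+1)·n + s·m < n²`), S1c `stub_regimeBudget` (arithmetic at `s = ⌊√n⌋`),
S1b `stub_fatBlockWeightLaw` (the LAW on the FAT-IRREDUCIBLE-FACTOR locus — the research residue), and `stub_seedExists` is DERIVED in-file.
HEADS (kernel-checked, no `sorry` outside `stub_*`): `uniformWeightLaw_of : ResidualWeightLaw → FlagWeightLaw → UniformWeightLaw` (case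
split on `HasCheapBlockFlag`), `heavyTopLaw_of : … → HeavyTopLaw` (✓ `heavyTopLaw_of_uniformWeightLaw`), ★ `dualUnipotentThreeHalves_of :
ResidualWeightLaw → FlagWeightLaw → DualUnipotentThreeHalves` (✓ `RadicalSplit.dualUnipotentThreeHalves_of_law` + ✓ `stub_radicalCoarsening`
= R1 by name), `dualUnipotentThreeHalves_of_stubs`.

Roster of record (desk #307 / R280 (2); director R298 (1) / R299 (4)): LEAD val-port-2 g3 by lineage (g2 drafted, registered and led revs 1–3a),
SECOND HAND val-port-4 g2 (S2), instrument + helper-file author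
val-port-3 g2, census cell val-htc-lead g0 / eng-1 (calibration rows), critic val-idea-crit-7 g0.
REV 4 (lead val-port-2 g3, crit-7 price L-4 paid in kernel): + import ✓ `…HeavyTopBlockMass`, + `fatBlockWeightLaw_iff_uniformWeightLaw`
(S1b ⟺ C⁺ — the fat factor locates the open case, it is not a lever), S1b docstring carries the free block-mass hypothesis for attackers;
registered stub set UNCHANGED = {`stub_fatBlockWeightLaw`}, sorries 1.
HONEST FRAMING: a skeleton.  Nothing here proves C⁺, R2 `HeavyTopLaw`, S3b, the crux `DualUnipotentThreeHalves`, rung 8062 or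
`VP ≠ VNP` — all OPEN / NOT proved; `sorry` occurs ONLY in `stub_fatBlockWeightLaw` (S1b) — THE LINE RESTS ON ONE RESEARCH STUB; S1a / S1c / S2 / S3 are closed by name
(✓ p658845 val-port-2 g2 / ✓ p658101 val-port-4 g2 / ✓ p652963 / ✓ p657049) — S1 `stub_seedExists` is derived, S2/S3
are closed by name (✓ p652963 / ✓ p657049); the glue S4 of R283 is the 20-line case split
`uniformWeightLaw_of`, PROVED in-file as R283 (i) directs, so the registered stubs are genuine lemmas on complementary loci (S3 now a theorem, S1 the research stub — to be CUT at L4 into the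
STRUCTURE lemma «¬HasCheapBlockFlag ⇒ fat composition factor» + monolith law + glue, crit-7 L-1) and none is `UniformWeightLaw` in one piece.
-/

set_option linter.dupNamespace false
set_option autoImplicit false

noncomputable section

namespace Summit.ValiantsHypothesis.ValiantsHypothesis.Cruxes.DualUnipotentThreeHalves.KrylovSeedLine

open MvPolynomial Matrix
open scoped BigOperators
open Summit.ValiantsHypothesis.ValiantsHypothesis.Cruxes.TwoDimCoefficients.DimTwoCases (AffMat IsAffine)
open Summit.ValiantsHypothesis.ValiantsHypothesis.Theorems.GrenetZeon.RadicalSplit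
  (FlagCheap linPart RadOrth HeavyTopLaw)
open Summit.ValiantsHypothesis.ValiantsHypothesis.Theorems.GrenetZeon.KrylovSeed
  (WeightThin UniformWeightLaw krylov flagCheap_of_weightThin heavyTopLaw_of_uniformWeightLaw weightThin_of_krylov)
open Summit.ValiantsHypothesis.ValiantsHypothesis.Theses.GrenetZeon (DualUnipotentThreeHalves)

/-! ## Objects -/

/-- **A CHEAP BLOCK FLAG of the pencil** (the hypothesis shape of ✓ p645496 `flagCheap_of_invariant_levels`, verbatim): a constant change
of basis `P` and a level function `lvl` with `p ≥ 1` levels making the PENCIL block-upper (`(P N P⁻¹)_{ij} = 0` for `lvl i < lvl j`),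
with the Theorem-G budget `p·n + Σ_{t<p} C(#{i : lvl i = t}, 2) < n²`. -/
def HasCheapBlockFlag (n m : ℕ) (N : AffMat n m) : Prop :=
  ∃ (P : (Matrix (Fin m) (Fin m) ℂ)ˣ) (lvl : Fin m → ℕ) (p : ℕ), 1 ≤ p ∧ (∀ i, lvl i < p) ∧
    (∀ i j : Fin m, lvl i < lvl j →
      ((P : Matrix (Fin m) (Fin m) ℂ).map C * N * (↑P⁻¹ : Matrix (Fin m) (Fin m) ℂ).map C :
        Matrix (Fin m) (Fin m) (MvPolynomial (Fin n × Fin n) ℂ)) i j = 0) ∧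
    p * n + ∑ t ∈ Finset.range p, ((Finset.univ.filter fun i => lvl i = t).card).choose 2 < n ^ 2

/-! ## Statements -/

/-- **S2 — FLAG WEIGHT LAW** (Theorem G, graded Gerstenhaber, in weight currency; provable now): an affine NILPOTENT pencil with a cheap
block flag is weight-thin.  No regime hypothesis, no heavy-top hypothesis. -/
def FlagWeightLaw : Prop :=
  ∀ (n m : ℕ) (N : AffMat n m), IsAffine N → N ^ m = 0 → HasCheapBlockFlag n m N → WeightThin n m N

/-- **S1 — RESIDUAL WEIGHT LAW** (LAW tier; the line's research content): in the regime `C₀ m² < n³`, a TOP-HEAVY affine nilpotent pencil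
WITHOUT a cheap block flag is weight-thin.  C⁺ = `UniformWeightLaw` restricted to the no-G-core-flag locus, which CONTAINS R2's residual
class (fat irreducible block); the converse inclusion is the lead's L4 structure lemma (crit-7 L-2). -/
def ResidualWeightLaw : Prop :=
  ∃ C₀ n₀ : ℕ, ∀ n ≥ n₀, ∀ m : ℕ, C₀ * m ^ 2 < n ^ 3 → ∀ N : AffMat n m, IsAffine N → N ^ m = 0 →
    (∀ K : Submodule ℂ (Fin n × Fin n → ℂ), RadOrth n m N K →
      Module.finrank ℂ K ≤ 16 * m * Nat.sqrt n + 16 * n) →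
    ¬ HasCheapBlockFlag n m N → WeightThin n m N

/-! ### L4 reshape (lead, cycle 1 → 2; crit-7 L-1): S1 is CUT into a structure lemma, an arithmetic lemma and the fat-block law -/

/-- **A SMALL-BLOCK STRUCTURE of the pencil at scale `s`**: a constant change of basis and a level function with `L` levels making the
PENCIL block-upper (polynomial entries `(i,j)` with `lvl i < lvl j` vanish) with EVERY block of size `≤ s`.  By ✓ port-4 g2's
`exists_block_conj` (p648257) the space `W = ℂ·N(0) + N_lin(ℂ^{n×n})` always has a block-upper structure with IRREDUCIBLE diagonal blocks
(a composition series of the `W`-module `ℂ^m`); so `¬ SmallBlockStructure n m N s` says in particular that this composition series has an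
irreducible factor of size `> s` — a FAT IRREDUCIBLE BLOCK, the residual class of record (INSTANCES.md §7). -/
def SmallBlockStructure (n m : ℕ) (N : AffMat n m) (s : ℕ) : Prop :=
  ∃ (P : (Matrix (Fin m) (Fin m) ℂ)ˣ) (L : ℕ) (lvl : Fin m → ℕ), (∀ i, lvl i < L) ∧
    (∀ i j : Fin m, lvl i < lvl j →
      ((P : Matrix (Fin m) (Fin m) ℂ).map C * N * (↑P⁻¹ : Matrix (Fin m) (Fin m) ℂ).map C :
        Matrix (Fin m) (Fin m) (MvPolynomial (Fin n × Fin n) ℂ)) i j = 0) ∧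
    (∀ t, t < L → (Finset.univ.filter fun i => lvl i = t).card ≤ s)

/-- **S1a — COARSE FLAG LEMMA** (M, provable now): a small-block structure at scale `s ≥ 1` can be COARSENED (merge consecutive blocks
greedily into groups of size `≤ 2s`, at most `m/s + 1` of them) into a cheap block flag as soon as `(m/s + 1)·n + s·m < n²`
(`Σ C(g_t,2) ≤ s·m` for groups of size `≤ 2s` summing to `m`).  The τ-law of the census (val-htc-lead 17:38:37Z LEMMA T) in kernel
currency. -/
def CoarseFlagLaw : Prop :=
  ∀ (n m : ℕ) (N : AffMat n m) (s : ℕ), 1 ≤ s → IsAffine N → SmallBlockStructure n m N s →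
    (m / s + 1) * n + s * m < n ^ 2 → HasCheapBlockFlag n m N

/-- **S1c — REGIME BUDGET** (S, pure arithmetic): deep in the regime the coarse-flag budget at scale `s = ⌊√n⌋` is available:
`∃ C₀ n₀, ∀ n ≥ n₀, ∀ m, C₀ m² < n³ → (m/⌊√n⌋ + 1)·n + ⌊√n⌋·m < n²` (e.g. `C₀ = 16`, `n₀ = 16`). -/
def RegimeBudget : Prop :=
  ∃ C₀ n₀ : ℕ, 1 ≤ n₀ ∧ ∀ n ≥ n₀, ∀ m : ℕ, C₀ * m ^ 2 < n ^ 3 → (m / Nat.sqrt n + 1) * n + Nat.sqrt n * m < n ^ 2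

/-- **S1b — FAT-BLOCK WEIGHT LAW** (LAW tier, research — the line's content after the cut): in the regime, a top-heavy affine nilpotent
pencil with NO small-block structure at scale `⌊√n⌋` — equivalently (✓ `exists_block_conj`) whose space `W` has an IRREDUCIBLE
composition factor of size `> ⌊√n⌋` — is weight-thin.  Routes: Krylov seeds (S2) inside the fat block + the coarse flag outside
(one global level function, card §HONEST (ii)), stabiliser-torus gradings (SEEDSPEC (T)); calibration as in S1's docstring (the
certificate search is over ALL level functions — crit-7 T2; (4,7)/(5,10)/(6,12) force `C₀ ≥ 2`; monoliths W₆/W₇/W₉ comply). -/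
def FatBlockWeightLaw : Prop :=
  ∃ C₀ n₀ : ℕ, ∀ n ≥ n₀, ∀ m : ℕ, C₀ * m ^ 2 < n ^ 3 → ∀ N : AffMat n m, IsAffine N → N ^ m = 0 →
    (∀ K : Submodule ℂ (Fin n × Fin n → ℂ), RadOrth n m N K →
      Module.finrank ℂ K ≤ 16 * m * Nat.sqrt n + 16 * n) →
    ¬ SmallBlockStructure n m N (Nat.sqrt n) → WeightThin n m N

/-! ## Stubs (registered targets of the line; `sorry` ONLY here) -/

/-- STUB S1a — the coarse flag lemma: a THEOREM on arrival — lead val-port-2 g2's ✓ p658845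
`Theorems/…HeavyTopCoarseFlag.lean :: KrylovSeed.coarseFlagLaw_unfolded` (coarse flag `lvl' i = #{lvl < lvl i}/s`, `p = m/s + 1`, coarse
blocks `≤ 2s − 1`, `Σ C ≤ s·m`; statement = this line's `CoarseFlagLaw` with `SmallBlockStructure` / `HasCheapBlockFlag` δ-unfolded). -/
theorem stub_coarseFlag : CoarseFlagLaw :=
  Summit.ValiantsHypothesis.ValiantsHypothesis.Theorems.GrenetZeon.KrylovSeed.coarseFlagLaw_unfolded

/-- STUB S1c — the regime budget at scale `⌊√n⌋`: a THEOREM on arrival — val-port-4 g2's ✓ p658101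
`Theorems/…HeavyTopRegimeBudget.lean :: KrylovSeed.regimeBudget_unfolded` (`C₀ = 36`, `n₀ = 4`; statement = this line's `RegimeBudget`
verbatim; by-name citation, δ-unfolding only). -/
theorem stub_regimeBudget : RegimeBudget :=
  Summit.ValiantsHypothesis.ValiantsHypothesis.Theorems.GrenetZeon.KrylovSeed.regimeBudget_unfolded

/-- STUB S1b (LAW, research; lead val-port-2 g2): the fat-block weight law — C⁺ on pencils whose nilpotent space has an irreducible
composition factor of size `> ⌊√n⌋` (the residual class of record, INSTANCES.md §7).  Calibration the law must respect (kernel / cell,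
by name): (4,7) `NSeven` — ✓ `not_weightThin_NSeven` with ✓ p648631 (C⁺ and R2 fail together at C₀ = 1); (5,10) P₁₀ and (6,12) P₁₂ —
`¬ WeightThin` by the cell's COMPLETE level-function DP (htc-lead 17:41:29Z / 17:44:58Z): like R2 the law needs `C₀ ≥ 2`; the certificate
search is over ALL level functions (crit-7 SEEDSPEC T2: W₇@(4,7) needs 5 levels, `(5,1,3)`; 𝓘_{q,k} needs a torus grading with
`r ≈ √n`) — so no pure `r = c = 1` Krylov law is claimed; monoliths W₆@(4,6), W₉@(5,9) (`(3,1,1)`), W₇@(4,7) ARE weight-thin — no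
counter-candidate inside the regime is known.  CALIBRATION (2), 20:12Z: W♯ := Irr₃ ⊕ C₈ ⊕ NT₄ ⊂ M₇ (val-idea-29 g2 card
`generic-corner-frame`, replicated 2-leg by val-htc-lead 20:12:40Z) is `¬ WeightThin 4 7` (index-sparse kill ✓ p651843) and
NON-triangularisable (Jordan–Hölder factor Irr₃ of size 3 > ⌊√4⌋, so `¬ SmallBlockStructure 4 7 _ 2`): THE LAW IS FALSE AT
`(C₀, n) = (1, 4)` — its constants must have `C₀ ≥ 2` or `n₀ ≥ 5` (W♯ lives in the C₀ = 1 sliver 49 < 64 only; at the C₀ = 2 cell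
(5,7) every corner frame is cheap — htc GRID §E; crit-7 20:22Z: instrument row, not a refutation; sharpened trigger #7′ = a certified
non-triangular ✗ at a C₀ ≥ 2 cell or a uniform-in-n family).  WHY IT MIGHT FAIL: a nilpotent quasi-expander (card §Lever).
**L-4 (crit-7 g2 V09/V11 (a)), rev 4, IN KERNEL: THE FAT FACTOR LOCATES THE OPEN CASE, IT IS NOT A LEVER.**  By ✓ lead val-port-2 g3's
`Theorems/…HeavyTopBlockMass.lean` the hypothesis `¬ SmallBlockStructure n m N ⌊√n⌋` is AUTOMATIC from heavy-top deep in the regime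
(`heavyTop_blockMass`: for ANY block-upper form after a constant `P`, `n² ≤ 16m√n + 16n + Σ_t C(k_t,2)`, because the direction space
killing the diagonal blocks is `RadOrth` of codimension `≤ Σ_t C(k_t,2)`; `two_sq_le_of_smallBlocks`: blocks `≤ s` ⇒ `2n² ≤ 2(16m√n+16n) +
(s−1)m`; `not_smallBlocks_sqrt_of_heavyTop`: impossible at `s = ⌊√n⌋` once `n ≥ 49`, `1089 m² < n³`), hence
`fatBlockWeightLaw_iff_uniformWeightLaw : FatBlockWeightLaw ↔ UniformWeightLaw` (below, two `exact`s): S1b IS C⁺ with constants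
`C₀ ≥ 1089`, `n₀ ≥ 49`.  What the attacker of S1b may therefore ASSUME for free (same theorem, contrapositive): EVERY block-upper form of
the pencil — in particular ✓ `exists_fat_irreducible_block`'s Jordan–Hölder form with irreducible diagonal blocks — has a block with
`(k_max − 1)·m ≥ 2(n² − 16m√n − 16n)`, i.e. ONE irreducible factor of size `≥ 2(1−ε)n²/m` (`≫ √n`, up to `m`); the coarse-flag branch
S1a∘S1c fires only OUTSIDE S1b's regime.  No second cut S1b ↦ S1b-irr ∧ S1b-glue is registered: the passenger padding `N ↦ N ⊕ N_fat`
(V09 §3) shows a glue stub would again be C⁺ in disguise; the honest registered residue stays ONE law, C⁺ itself on its natural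
locus. -/
theorem stub_fatBlockWeightLaw : FatBlockWeightLaw := by
  sorry

/-- **L-4 IN KERNEL (rev 4): S1b ⟺ C⁺.**  The fat-block weight law and the uniform weight law imply each other — ✓ lead val-port-2 g3
`KrylovSeed.uniformWeightLaw_of_fatBlockLaw` (enlarge the constants to `C₀ ≥ 1089`, `n₀ ≥ 49`; then `¬ SmallBlockStructure n m N ⌊√n⌋`
holds automatically by `not_smallBlocks_sqrt_of_heavyTop`) and `KrylovSeed.fatBlockLaw_of_uniformWeightLaw` (drop the hypothesis);
statement δ-unfolded there, cited here by name.  Consequently the line's only `sorry` is EXACTLY C⁺ = `UniformWeightLaw` on its natural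
locus; nothing weaker is claimed closed. -/
theorem fatBlockWeightLaw_iff_uniformWeightLaw : FatBlockWeightLaw ↔ UniformWeightLaw :=
  ⟨Summit.ValiantsHypothesis.ValiantsHypothesis.Theorems.GrenetZeon.KrylovSeed.uniformWeightLaw_of_fatBlockLaw,
   Summit.ValiantsHypothesis.ValiantsHypothesis.Theorems.GrenetZeon.KrylovSeed.fatBlockLaw_of_uniformWeightLaw⟩

/-- **S1 — SEED EXISTENCE on the no-G-core-flag locus** (`ResidualWeightLaw`), now a THEOREM from the cut S1a ∧ S1b ∧ S1c: in the
regime (constants = the max of S1b's and S1c's), a pencil without a cheap block flag has, by the coarse flag lemma at scale `⌊√n⌋` and the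
regime budget, NO small-block structure at that scale, i.e. a fat irreducible factor, and the fat-block law makes it weight-thin. -/
theorem stub_seedExists : ResidualWeightLaw := by
  obtain ⟨Cb, nb, hb⟩ := stub_fatBlockWeightLaw
  obtain ⟨Cc, nc, hnc, hc⟩ := stub_regimeBudget
  refine ⟨max Cb Cc, max nb nc, fun n hn m hreg N hN hnil htop hno => ?_⟩
  have hnb : nb ≤ n := le_trans (le_max_left _ _) hn
  have hncn : nc ≤ n := le_trans (le_max_right _ _) hn
  have hregb : Cb * m ^ 2 < n ^ 3 := lt_of_le_of_lt (Nat.mul_le_mul_right _ (le_max_left _ _)) hreg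
  have hregc : Cc * m ^ 2 < n ^ 3 := lt_of_le_of_lt (Nat.mul_le_mul_right _ (le_max_right _ _)) hreg
  have hs : 1 ≤ Nat.sqrt n := Nat.sqrt_pos.mpr (by omega)
  have hsmall : ¬ SmallBlockStructure n m N (Nat.sqrt n) := fun hS =>
    hno (stub_coarseFlag n m N (Nat.sqrt n) hs hN hS (hc n hncn m hregc))
  exact hb n hnb m hregb N hN hnil htop hsmall

/-- STUB S3 — **THE INVARIANT-FLAG LOCUS**: the flag weight law — a THEOREM on arrival: val-port-4 g2's ✓ p657049
`KrylovSeed.weightThin_of_invariant_levels` / `flagWeightLaw_unfolded` (Theorem G's graded Gerstenhaber count in weight currency over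
✓ p653819 `weightThin_of_block_levels`), statement = this line's `FlagWeightLaw` unfolded verbatim; by-name citation, δ-unfolding only. -/
theorem stub_invariantFlagLocus : FlagWeightLaw :=
  -- CLOSED BY NAME (val-port-4 g2, ✓ p657049 `…HeavyTopFlagWeightThin :: KrylovSeed.flagWeightLaw_unfolded`, δ-unfolding only)
  Summit.ValiantsHypothesis.ValiantsHypothesis.Theorems.GrenetZeon.KrylovSeed.flagWeightLaw_unfolded

/-- STUB S2 (CLOSED ON ARRIVAL — lemma B of the card, ✓ p652963 `KrylovSeed.weightThin_of_krylov`): **SEED ⇒ WEIGHT-THIN**.  If the values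
of the pencil lie in `W`, the Krylov flag of a seed `S` reaches `⊤` at step `p`, every top `N_lin(v)`, `v ∈ K`, LIFTS the flag
(`N_lin(v)·F_{t+1} ⊆ F_t`), and `(⌊(p−1+(n−1))/2⌋+1)·n < dim K`, then the pencil is weight-thin (`r = c = 1`).  This is the joint through
which a seed-existence theorem on (a sub-class of) the residual class discharges S1 there. -/
theorem stub_seedToWeightThin {n m : ℕ} (N : AffMat n m) (hN : IsAffine N)
    (W : Submodule ℂ (Matrix (Fin m) (Fin m) ℂ)) (hW₀ : ∀ x : Fin n × Fin n → ℂ, N.map (MvPolynomial.eval x) ∈ W)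
    (S : Submodule ℂ (Fin m → ℂ)) (p : ℕ) (htop : krylov W S p = ⊤)
    (K : Submodule ℂ (Fin n × Fin n → ℂ))
    (hK : ∀ v ∈ K, ∀ t : ℕ, ∀ y ∈ krylov W S (t + 1), (linPart N v).mulVec y ∈ krylov W S t)
    (hdim : ((p - 1 + (n - 1)) / 2 + 1) * n < Module.finrank ℂ K) :
    WeightThin n m N :=
  weightThin_of_krylov N hN W hW₀ S p htop K hK hdim

/-! ## Heads (kernel-checked compositions; no `sorry` below this line) -/

/-- **GLUE.**  The two laws cover every pencil: C⁺ = `UniformWeightLaw` follows from S1 and S2 (case split on the cheap block flag; S2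
does not even use the regime or the heavy-top hypothesis). -/
theorem uniformWeightLaw_of (h1 : ResidualWeightLaw) (h2 : FlagWeightLaw) : UniformWeightLaw := by
  obtain ⟨C₀, n₀, hres⟩ := h1
  refine ⟨C₀, n₀, fun n hn m hreg N hN hnil htop => ?_⟩
  by_cases hF : HasCheapBlockFlag n m N
  · exact h2 n m N hN hnil hF
  · exact hres n hn m hreg N hN hnil htop hF

/-- **R2 from the stubs**: `HeavyTopLaw` (✓ `heavyTopLaw_of_uniformWeightLaw`). -/
theorem heavyTopLaw_of (h1 : ResidualWeightLaw) (h2 : FlagWeightLaw) : HeavyTopLaw :=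
  heavyTopLaw_of_uniformWeightLaw (uniformWeightLaw_of h1 h2)

/-- ★ **THE CRUX BY NAME from the stubs**: `DualUnipotentThreeHalves` (stmt-24318), through `radical_split`'s kernel-checked composition
`dualUnipotentThreeHalves_of_law` (R1 `stub_radicalCoarsening` is the landed theorem ✓ p623799; R2 = `heavyTopLaw_of`). -/
theorem dualUnipotentThreeHalves_of (h1 : ResidualWeightLaw) (h2 : FlagWeightLaw) : DualUnipotentThreeHalves :=
  RadicalSplit.dualUnipotentThreeHalves_of_law RadicalSplit.stub_radicalCoarsening (heavyTopLaw_of h1 h2)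

/-- Composition modulo the two open stubs S1, S2 (S3 is a theorem). -/
theorem dualUnipotentThreeHalves_of_stubs : DualUnipotentThreeHalves :=
  dualUnipotentThreeHalves_of stub_seedExists stub_invariantFlagLocus

/-! ## Calibration by name (no new content; see the module docstring)

* `KrylovSeed.not_weightThin_NSeven : ¬ WeightThin 4 7 NSeven` (✓ p652963) — C⁺ and R2 fail TOGETHER at the C₀ = 1 format (4,7)
  (✓ p648631 `not_heavyTopInst_four_seven`); the cell certifies `¬ WeightThin` for P₁₀@(5,10), P₁₂@(6,12) (htc-lead 17:44:58Z): C₀ ≥ 2.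
* `KrylovSeed.weightThin_of_block_levels` / `weightThin_of_triangularisable_sharp` (✓ p653819) — the triangularisable / G-core rows of
  the instance table are weight-thin: C⁺ agrees with R2 wherever R2 was decided TRUE. -/

end Summit.ValiantsHypothesis.ValiantsHypothesis.Cruxes.DualUnipotentThreeHalves.KrylovSeedLine

end
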